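import Literature.Computability.QuantumComplexity.PauliExpansion
import Literature.LinearAlgebra.Matrix.PosSemidefTrace
import HarnessLib

/-!
# One-qubit channels: a pointwise purity/contraction bound

Towards Lemma 8 of Kempe–Regev–Unger–de Wolf, *Upper bounds on the noise threshold for
fault-tolerant quantum computing*, Quantum Inf. Comput. 10 (2010) 361–376 [KempeEtAl2010]
(`∃ β ∈ [0,1]`, `|δ'_*|² ≤ (1−β) δ̂(I)² + β |δ_*|²` for every one-qubit CPTP map). The printed
proof uses the Ruskai–Szarek–Werner normal form of qubit channels; we replace it by the
following two steps, of which this file is the first: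

* (**pointwise bound**, `re_trace_kraus_sq_le_max`) for a Kraus family `K` with
  `Σ Kᵢᴴ Kᵢ = 1` (a CPTP map `Φ(δ) = Σ Kᵢ δ Kᵢᴴ`, in fact only positivity and trace
  preservation are used) and every Hermitian `2 × 2` matrix `δ`,
  `Tr(Φ(δ)²) ≤ max((Tr δ)², Tr(δ²))`.
  Proof: the by-hand spectral decomposition `δ = λ₊ ρ₊ + λ₋ ρ₋` of a Hermitian `2 × 2` matrix
  into orthogonal pure states (`exists_unit_decomposition`: `δ = (Tr δ/2)·1 + s·u` with
  `u² = 1`, `Tr u = 0`, `s ≥ 0`); if `λ₊ λ₋ ≥ 0` then `±δ ⪰ 0` and purity of `Φ(±δ) ⪰ 0` gives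
  `(Tr δ)²`; otherwise `Tr(Φ(δ)²) = λ₊² Tr Φ(ρ₊)² + λ₋² Tr Φ(ρ₋)² + 2 λ₊λ₋ Tr(Φ(ρ₊)Φ(ρ₋))
  ≤ λ₊² + λ₋² = Tr(δ²)` since `Tr(Φ(ρ₊)Φ(ρ₋)) ≥ 0`;
* the second step (`QubitChannelLemma8.lean`) feeds this into Yuan's lemma on two quadratic
  forms (`Literature.Analysis.Convexity.yuan_lemma`) to produce the single `β`.

Also recorded: positivity and trace preservation of Kraus maps (`posSemidef_kraus`,
`trace_kraus`), the `2 × 2` identity `M² = (Tr M²/2)·1` for traceless `M`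
(`mul_self_eq_smul_one_of_trace_eq_zero`, Cayley–Hamilton), and the one-qubit Parseval identity
`trace_mul_self_eq_half_sum_sq` (`Tr(M²) = ½ Σ_Q Tr(σ_Q M)²`, §2).

## References

* [KempeEtAl2010] J. Kempe, O. Regev, F. Unger, R. de Wolf, Quantum Inf. Comput. 10 (2010)
  361–376; arXiv:0802.1464, §2 and Lemma 8 (§3.1.2, Case 2).
-/

noncomputable section

open Matrix Finset
open scoped ComplexOrder MatrixOrder

namespace Literature.Computability.QuantumComplexity

/-! ### Kraus maps: positivity and trace preservation -/

section Kraus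

variable {n κ : Type*} [Fintype n] [DecidableEq n] [Fintype κ]

omit [DecidableEq n] in
/-- A Kraus map `δ ↦ Σ Kᵢ δ Kᵢᴴ` preserves positive semidefiniteness.
[cite: KempeEtAl2010, §1 (completely-positive one-qubit gates)] -/
theorem posSemidef_kraus (K : κ → Matrix n n ℂ) {M : Matrix n n ℂ} (hM : M.PosSemidef) :
    (∑ i, K i * M * (K i)ᴴ).PosSemidef :=
  posSemidef_sum Finset.univ fun i _ => hM.mul_mul_conjTranspose_same (K i)

/-- A Kraus map with `Σ Kᵢᴴ Kᵢ = 1` preserves the trace. [cite: KempeEtAl2010, §1 (trace-preserving one-qubit gates)] -/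
theorem trace_kraus (K : κ → Matrix n n ℂ) (hK : ∑ i, (K i)ᴴ * K i = 1) (M : Matrix n n ℂ) :
    (∑ i, K i * M * (K i)ᴴ).trace = M.trace := by
  rw [trace_sum]
  have : ∀ i, (K i * M * (K i)ᴴ).trace = ((K i)ᴴ * K i * M).trace := fun i => by
    rw [trace_mul_cycle, Matrix.mul_assoc]
  simp only [this, ← trace_sum, ← Finset.sum_mul, hK, Matrix.one_mul]

omit [DecidableEq n] in
/-- A Kraus map preserves Hermiticity. [folklore] -/
theorem isHermitian_kraus (K : κ → Matrix n n ℂ) {M : Matrix n n ℂ} (hM : M.IsHermitian) :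
    (∑ i, K i * M * (K i)ᴴ).IsHermitian := by
  unfold Matrix.IsHermitian
  rw [conjTranspose_sum]
  refine Finset.sum_congr rfl fun i _ => ?_
  rw [conjTranspose_mul, conjTranspose_mul, conjTranspose_conjTranspose, hM, Matrix.mul_assoc]

omit [DecidableEq n] in
/-- Kraus maps are additive. [folklore] -/
theorem kraus_add (K : κ → Matrix n n ℂ) (M N : Matrix n n ℂ) :
    ∑ i, K i * (M + N) * (K i)ᴴ = ∑ i, K i * M * (K i)ᴴ + ∑ i, K i * N * (K i)ᴴ := by
  rw [← Finset.sum_add_distrib]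
  refine Finset.sum_congr rfl fun i _ => ?_
  rw [Matrix.mul_add, Matrix.add_mul]

omit [DecidableEq n] in
/-- Kraus maps are homogeneous. [folklore] -/
theorem kraus_smul (K : κ → Matrix n n ℂ) (c : ℂ) (M : Matrix n n ℂ) :
    ∑ i, K i * (c • M) * (K i)ᴴ = c • ∑ i, K i * M * (K i)ᴴ := by
  rw [Finset.smul_sum]
  refine Finset.sum_congr rfl fun i _ => ?_
  rw [Matrix.mul_smul, Matrix.smul_mul]

omit [DecidableEq n] in
/-- Kraus maps commute with negation. [folklore] -/
theorem kraus_neg (K : κ → Matrix n n ℂ) (M : Matrix n n ℂ) :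
    ∑ i, K i * (-M) * (K i)ᴴ = -∑ i, K i * M * (K i)ᴴ := by
  rw [← neg_one_smul ℂ M, kraus_smul, neg_one_smul]

end Kraus

/-! ### `2 × 2` matrices over `Bool` -/

/-- Cayley–Hamilton for a traceless `2 × 2` matrix: `M² = (Tr M² / 2) · 1`. [folklore] -/
theorem mul_self_eq_smul_one_of_trace_eq_zero {M : Matrix Bool Bool ℂ} (hM : M.trace = 0) :
    M * M = ((M * M).trace / 2) • (1 : Matrix Bool Bool ℂ) := by
  have ht : M true true = -M false false := by
    rw [Matrix.trace, Fintype.sum_bool] at hM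
    simpa [Matrix.diag_apply] using eq_neg_of_add_eq_zero_left hM
  ext a b
  cases a <;> cases b <;>
    simp [Matrix.trace, Matrix.diag_apply, Pauli.mul_apply_bool, ht] <;> ring

/-- **One-qubit Parseval**: `Tr(M²) = ½ Σ_Q Tr(σ_Q M)²` for every `2 × 2` complex matrix
(orthogonality `Tr(σ_Q σ_Q') = 2[Q = Q']` applied to the expansion `M = ½ Σ_Q Tr(σ_Q M) σ_Q`).
[cite: KempeEtAl2010, §2 (Tr(δ²) = 2^{-n} Σ_S δ̂(S)²)] -/
theorem trace_mul_self_eq_half_sum_sq (M : Matrix Bool Bool ℂ) :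
    (M * M).trace = (1 / 2 : ℂ) * ∑ Q, (Pauli.mat Q * M).trace ^ 2 := by
  set c : Pauli → ℂ := fun Q => (Pauli.mat Q * M).trace with hc
  have hM : M = (1 / 2 : ℂ) • ∑ Q, c Q • Pauli.mat Q := Pauli.eq_half_sum_trace_smul M
  have key : ∀ Q, (Pauli.mat Q * M).trace = c Q := fun Q => rfl
  conv_lhs => rw [hM]
  simp only [Matrix.smul_mul, Matrix.mul_smul, Finset.sum_mul, Finset.mul_sum, trace_smul,
    trace_sum, smul_eq_mul, Pauli.trace_mat_mul_mat, mul_ite, mul_zero, Finset.sum_ite_eq',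
    Finset.mem_univ, if_true]
  simp only [key, ← Finset.mul_sum]
  ring_nf

/-- For Hermitian `2 × 2` matrices `H, H'`, `Tr(H H')` is real. [folklore] -/
theorem trace_mul_im_of_isHermitian {n : Type*} [Fintype n] {H H' : Matrix n n ℂ}
    (hH : H.IsHermitian) (hH' : H'.IsHermitian) : (H * H').trace.im = 0 := by
  have h : star (H * H').trace = (H * H').trace := by
    rw [← trace_conjTranspose, conjTranspose_mul, hH, hH', trace_mul_comm]
  have := congrArg Complex.im h
  rw [Complex.star_def, Complex.conj_im] at this
  linarith

/-- **By-hand spectral decomposition of a Hermitian `2 × 2` matrix**: `δ = (Tr δ / 2)·1 + s·u`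
with `u` a traceless Hermitian involution (`u² = 1`) and `s ≥ 0` (so `δ = λ₊ ρ₊ + λ₋ ρ₋` with
the orthogonal projections `ρ± = (1 ± u)/2` and `λ± = Tr δ/2 ± s`). [folklore] -/
theorem exists_unit_decomposition {δ : Matrix Bool Bool ℂ} (hδ : δ.IsHermitian) :
    ∃ (u : Matrix Bool Bool ℂ) (s : ℝ), u.IsHermitian ∧ u * u = 1 ∧ u.trace = 0 ∧ 0 ≤ s ∧
      δ = ((δ.trace.re / 2 : ℝ) : ℂ) • (1 : Matrix Bool Bool ℂ) + (s : ℂ) • u := by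
  -- the traceless part
  set a : ℝ := δ.trace.re with ha
  have htr : δ.trace = (a : ℂ) := by
    apply Complex.ext
    · simp [ha]
    · rw [Complex.ofReal_im]
      have h : star δ.trace = δ.trace := by rw [← trace_conjTranspose, hδ]
      have := congrArg Complex.im h
      rw [Complex.star_def, Complex.conj_im] at this
      linarith
  set δ₀ : Matrix Bool Bool ℂ := δ - ((a / 2 : ℝ) : ℂ) • 1 with hδ₀
  have hδ₀h : δ₀.IsHermitian := by
    refine hδ.sub ?_
    unfold Matrix.IsHermitian
    rw [conjTranspose_smul, conjTranspose_one, Complex.star_def, Complex.conj_ofReal]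
  have hδ₀t : δ₀.trace = 0 := by
    rw [hδ₀, trace_sub, trace_smul, trace_one, Fintype.card_bool, htr, smul_eq_mul]
    push_cast; ring
  -- `c = Tr(δ₀²)/2` is real and nonnegative
  set c : ℝ := (δ₀ * δ₀).trace.re / 2 with hc
  have hcC : (δ₀ * δ₀).trace / 2 = (c : ℂ) := by
    apply Complex.ext
    · simp [hc]
    · rw [Complex.ofReal_im, Complex.div_im]
      simp [trace_mul_im_of_isHermitian hδ₀h hδ₀h]
  have hc0 : 0 ≤ c := by
    rw [hc]
    have : δ₀ * δ₀ = δ₀ * δ₀ᴴ := by rw [hδ₀h]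
    rw [this]
    have h := Literature.LinearAlgebra.Matrix.re_trace_mul_nonneg_of_posSemidef
      (Matrix.posSemidef_self_mul_conjTranspose δ₀) Matrix.PosSemidef.one
    rw [Matrix.mul_one] at h
    linarith
  have hsq : δ₀ * δ₀ = (c : ℂ) • (1 : Matrix Bool Bool ℂ) := by
    rw [mul_self_eq_smul_one_of_trace_eq_zero hδ₀t, hcC]
  have hδeq : δ = ((a / 2 : ℝ) : ℂ) • (1 : Matrix Bool Bool ℂ) + δ₀ := by
    rw [hδ₀]; abel
  by_cases hcz : c = 0
  · -- `δ₀ = 0`: take `u = Z`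
    have hδ₀z : δ₀ = 0 := by
      have h1 : δ₀ᴴ * δ₀ = 0 := by rw [hδ₀h, hsq, hcz]; simp
      exact Matrix.conjTranspose_mul_self_eq_zero.1 h1
    refine ⟨Pauli.mat Pauli.Z, 0, ?_, Pauli.mat_mul_self _, ?_, le_rfl, ?_⟩
    · exact Pauli.conjTranspose_mat _
    · have := Pauli.trace_mat_mul_mat Pauli.Z Pauli.I
      simpa [Pauli.mat] using this
    · rw [hδeq, hδ₀z]; simp [ha]
  · -- `c > 0`: normalise `δ₀`
    have hcpos : 0 < c := lt_of_le_of_ne hc0 (Ne.symm hcz)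
    set s : ℝ := Real.sqrt c with hs
    have hs0 : 0 < s := Real.sqrt_pos.2 hcpos
    have hss : s * s = c := Real.mul_self_sqrt hc0
    refine ⟨((s⁻¹ : ℝ) : ℂ) • δ₀, s, ?_, ?_, ?_, hs0.le, ?_⟩
    · unfold Matrix.IsHermitian
      rw [conjTranspose_smul, hδ₀h, Complex.star_def, Complex.conj_ofReal]
    · rw [Matrix.smul_mul, Matrix.mul_smul, hsq, smul_smul, smul_smul, ← Complex.ofReal_mul,
        ← Complex.ofReal_mul, ← hss]
      field_simp
      simp
    · rw [trace_smul, hδ₀t, smul_zero]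
    · rw [smul_smul, ← Complex.ofReal_mul, mul_inv_cancel₀ hs0.ne', Complex.ofReal_one, one_smul]
      exact hδeq

/-! ### Pure-state projections `(1 ± u)/2` -/

section Projections

variable {u : Matrix Bool Bool ℂ}

/-- `(1 + u)/2` and `(1 - u)/2` are orthogonal idempotents summing to `1` when `u² = 1`.
[folklore] -/
theorem half_one_add_mul_half_one_sub (huu : u * u = 1) :
    ((1 / 2 : ℂ) • (1 + u)) * ((1 / 2 : ℂ) • (1 - u)) = 0 ∧
    ((1 / 2 : ℂ) • (1 - u)) * ((1 / 2 : ℂ) • (1 + u)) = 0 ∧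
    ((1 / 2 : ℂ) • (1 + u)) * ((1 / 2 : ℂ) • (1 + u)) = (1 / 2 : ℂ) • (1 + u) ∧
    ((1 / 2 : ℂ) • (1 - u)) * ((1 / 2 : ℂ) • (1 - u)) = (1 / 2 : ℂ) • (1 - u) := by
  simp only [Matrix.smul_mul, Matrix.mul_smul, Matrix.add_mul, Matrix.mul_add,
    Matrix.sub_mul, Matrix.mul_sub, Matrix.one_mul, Matrix.mul_one, huu]
  exact ⟨by module, by module, by module, by module⟩

/-- For a traceless Hermitian involution `u`, `(1 ± u)/2` are density matrices (positive
semidefinite of trace one). [folklore] -/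
theorem posSemidef_half_one_add (hu : u.IsHermitian) (huu : u * u = 1) (hut : u.trace = 0) :
    ((1 / 2 : ℂ) • (1 + u)).PosSemidef ∧ ((1 / 2 : ℂ) • (1 - u)).PosSemidef ∧
    ((1 / 2 : ℂ) • (1 + u)).trace = 1 ∧ ((1 / 2 : ℂ) • (1 - u)).trace = 1 := by
  obtain ⟨-, -, hpp, hmm⟩ := half_one_add_mul_half_one_sub huu
  have h2 : star (1 / 2 : ℂ) = 1 / 2 := by
    rw [Complex.star_def, map_div₀, map_one, map_ofNat]
  have hph : ((1 / 2 : ℂ) • (1 + u))ᴴ = (1 / 2 : ℂ) • (1 + u) := by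
    rw [conjTranspose_smul, conjTranspose_add, conjTranspose_one, hu, h2]
  have hmh : ((1 / 2 : ℂ) • (1 - u))ᴴ = (1 / 2 : ℂ) • (1 - u) := by
    rw [conjTranspose_smul, conjTranspose_sub, conjTranspose_one, hu, h2]
  refine ⟨?_, ?_, ?_, ?_⟩
  · have h := Matrix.posSemidef_conjTranspose_mul_self ((1 / 2 : ℂ) • (1 + u))
    rwa [hph, hpp] at h
  · have h := Matrix.posSemidef_conjTranspose_mul_self ((1 / 2 : ℂ) • (1 - u))
    rwa [hmh, hmm] at h
  · rw [trace_smul, trace_add, trace_one, hut, Fintype.card_bool, smul_eq_mul]; norm_num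
  · rw [trace_smul, trace_sub, trace_one, hut, Fintype.card_bool, smul_eq_mul]; norm_num

end Projections

/-! ### The pointwise bound -/

/-- **Pointwise purity/contraction bound for one-qubit channels.** For a Kraus family with
`Σ Kᵢᴴ Kᵢ = 1` and a Hermitian `2 × 2` matrix `δ`:
`Tr(Φ(δ)²) ≤ max((Tr δ)², Tr(δ²))`, `Φ(δ) = Σ Kᵢ δ Kᵢᴴ`. If `δ` is semidefinite this is the
purity bound for the state `Φ(±δ)`; otherwise `δ = λ₊ρ₊ + λ₋ρ₋` with `λ₊λ₋ < 0` and
orthogonal pure `ρ±`, and `Tr(Φ(ρ₊)Φ(ρ₋)) ≥ 0` kills the cross term. (Replaces the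
Ruskai–Szarek–Werner normal form in the proof of Lemma 8.)
[cite: KempeEtAl2010, Lemma 8 (proof, reorganised)] -/
theorem re_trace_kraus_sq_le_max {κ : Type*} [Fintype κ] (K : κ → Matrix Bool Bool ℂ)
    (hK : ∑ i, (K i)ᴴ * K i = 1) {δ : Matrix Bool Bool ℂ} (hδ : δ.IsHermitian) :
    ((∑ i, K i * δ * (K i)ᴴ) * (∑ i, K i * δ * (K i)ᴴ)).trace.re ≤
      max (δ.trace.re ^ 2) ((δ * δ).trace.re) := by
  obtain ⟨u, s, hu, huu, hut, hs, hδeq⟩ := exists_unit_decomposition hδ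
  obtain ⟨hpm, hmp, hpp, hmm⟩ := half_one_add_mul_half_one_sub huu
  obtain ⟨hp_psd, hm_psd, hp_tr, hm_tr⟩ := posSemidef_half_one_add hu huu hut
  -- opaque names for the two projections and the Kraus map
  obtain ⟨ρp, hρp⟩ : ∃ ρp : Matrix Bool Bool ℂ, ρp = (1 / 2 : ℂ) • (1 + u) := ⟨_, rfl⟩
  obtain ⟨ρm, hρm⟩ : ∃ ρm : Matrix Bool Bool ℂ, ρm = (1 / 2 : ℂ) • (1 - u) := ⟨_, rfl⟩
  rw [← hρp] at hpp hp_psd hp_tr hpm hmp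
  rw [← hρm] at hmm hm_psd hm_tr hpm hmp
  obtain ⟨Φ, hΦ⟩ : ∃ Φ : Matrix Bool Bool ℂ → Matrix Bool Bool ℂ,
      Φ = fun M => ∑ i, K i * M * (K i)ᴴ := ⟨_, rfl⟩
  have hΦadd : ∀ M N, Φ (M + N) = Φ M + Φ N := fun M N => by rw [hΦ]; exact kraus_add K M N
  have hΦsmul : ∀ (c : ℂ) M, Φ (c • M) = c • Φ M := fun c M => by rw [hΦ]; exact kraus_smul K c M
  have hΦtr : ∀ M, (Φ M).trace = M.trace := fun M => by rw [hΦ]; exact trace_kraus K hK M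
  have hΦpsd : ∀ M, M.PosSemidef → (Φ M).PosSemidef := fun M hM => by
    rw [hΦ]; exact posSemidef_kraus K hM
  rw [show (∑ i, K i * δ * (K i)ᴴ) = Φ δ by rw [hΦ]]
  set a : ℝ := δ.trace.re with ha
  set lp : ℝ := a / 2 + s with hlp
  set lm : ℝ := a / 2 - s with hlm
  -- `δ = lp ρp + lm ρm`
  have hδ' : δ = (lp : ℂ) • ρp + (lm : ℂ) • ρm := by
    rw [hδeq, hρp, hρm, smul_smul, smul_smul, smul_add, smul_sub, hlp, hlm]
    push_cast
    module
  -- purity of the images of positive matrices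
  have purity : ∀ M : Matrix Bool Bool ℂ, M.PosSemidef →
      (Φ M * Φ M).trace.re ≤ M.trace.re ^ 2 := by
    intro M hM
    have h := Literature.LinearAlgebra.Matrix.re_trace_mul_self_le_sq_of_posSemidef (hΦpsd M hM)
    rwa [hΦtr] at h
  by_cases hsign : 0 ≤ lp * lm
  · -- semidefinite case: `ε δ ⪰ 0` for a sign `ε`
    obtain ⟨ε, hε, hεp, hεm⟩ : ∃ ε : ℝ, ε ^ 2 = 1 ∧ 0 ≤ ε * lp ∧ 0 ≤ ε * lm := by
      by_cases hm0 : 0 ≤ lm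
      · exact ⟨1, by norm_num, by rw [one_mul]; linarith, by rwa [one_mul]⟩
      · push Not at hm0
        have : lp ≤ 0 := by
          by_contra hcon
          push Not at hcon
          nlinarith
        exact ⟨-1, by norm_num, by linarith, by linarith⟩
    have hεδ : ((ε : ℂ) • δ).PosSemidef := by
      rw [hδ', smul_add, smul_smul, smul_smul, ← Complex.ofReal_mul, ← Complex.ofReal_mul]
      exact (hp_psd.smul (Complex.zero_le_real.2 hεp)).add
        (hm_psd.smul (Complex.zero_le_real.2 hεm))
    have h := purity _ hεδ
    rw [hΦsmul, Matrix.smul_mul, Matrix.mul_smul, smul_smul, trace_smul, trace_smul, smul_eq_mul,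
      smul_eq_mul, ← Complex.ofReal_mul, ← sq, hε, Complex.ofReal_one, one_mul,
      Complex.re_ofReal_mul, mul_pow, hε, one_mul] at h
    exact h.trans (le_max_left _ _)
  · -- indefinite case: expand along `ρp, ρm`
    push Not at hsign
    have hΦδ : Φ δ = (lp : ℂ) • Φ ρp + (lm : ℂ) • Φ ρm := by
      rw [hδ', hΦadd, hΦsmul, hΦsmul]
    have hC := Literature.LinearAlgebra.Matrix.re_trace_mul_nonneg_of_posSemidef
      (hΦpsd ρp hp_psd) (hΦpsd ρm hm_psd)
    have hAp := purity ρp hp_psd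
    have hAm := purity ρm hm_psd
    rw [hp_tr, Complex.one_re, one_pow] at hAp
    rw [hm_tr, Complex.one_re, one_pow] at hAm
    have hcomm : (Φ ρm * Φ ρp).trace = (Φ ρp * Φ ρm).trace := trace_mul_comm _ _
    have hexp : (Φ δ * Φ δ).trace = (lp : ℂ) ^ 2 * (Φ ρp * Φ ρp).trace +
        (lm : ℂ) ^ 2 * (Φ ρm * Φ ρm).trace + 2 * (lp : ℂ) * (lm : ℂ) * (Φ ρp * Φ ρm).trace := by
      rw [hΦδ]
      simp only [Matrix.add_mul, Matrix.mul_add, Matrix.smul_mul, Matrix.mul_smul,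
        trace_add, trace_smul, smul_eq_mul, hcomm]
      ring
    have hδδ : (δ * δ).trace = (lp : ℂ) ^ 2 + (lm : ℂ) ^ 2 := by
      rw [hδ']
      simp only [Matrix.add_mul, Matrix.mul_add, Matrix.smul_mul, Matrix.mul_smul,
        trace_add, trace_smul, smul_eq_mul]
      rw [hpp, hmm, hpm, hmp, hp_tr, hm_tr, trace_zero]
      ring
    have hre : (Φ δ * Φ δ).trace.re = lp ^ 2 * (Φ ρp * Φ ρp).trace.re +
        lm ^ 2 * (Φ ρm * Φ ρm).trace.re + 2 * lp * lm * (Φ ρp * Φ ρm).trace.re := by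
      rw [hexp]
      simp only [Complex.add_re, Complex.mul_re, Complex.mul_im, ← Complex.ofReal_pow,
        Complex.ofReal_re, Complex.ofReal_im, Complex.re_ofNat, Complex.im_ofNat]
      ring
    have hδδre : (δ * δ).trace.re = lp ^ 2 + lm ^ 2 := by
      rw [hδδ]
      simp only [Complex.add_re, ← Complex.ofReal_pow, Complex.ofReal_re]
    refine le_trans ?_ (le_max_right _ _)
    rw [hre, hδδre]
    nlinarith [sq_nonneg lp, sq_nonneg lm, mul_nonneg (sq_nonneg lp) (sub_nonneg.2 hAp),
      mul_nonneg (sq_nonneg lm) (sub_nonneg.2 hAm), mul_nonneg (neg_nonneg.2 hsign.le) hC]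

end Literature.Computability.QuantumComplexity
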